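import Summits.HodgeConjecture.HodgeConjecture.Theorems.NikulinTwinTransportLefschetzOneOneK3
import Literature.AlgebraicGeometry.HodgeTheory.HodgeFiltrationModelsReductionProofs

/-!
# Route NikulinTwinTransport — `LefschetzOneOneK3` (item stmt-HodgeConjecture-13678): the rigidity input is discharged

The K3-local rigidity line of `NikulinTwinTransportLefschetzOneOneK3.lean`,
`lefschetzOneOneK3_of_rigidity_of_globalSections`, reduces the route item `LefschetzOneOneK3`
(Lefschetz's theorem on `(1,1)`-classes for projective K3 surfaces, on the real carriers) to three
inputs: (R) the rigidity of natural de Rham comparisons `NaturalDeRhamComparisonRigidity`, (L) the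
printed Lefschetz `(1,1)` theorem in Chern–Weil form for ONE natural comparison family per model
space (`ComplexDeRhamIsoFamily.IsLefschetzOneOne`, Voisin I Thm. 11.30 with Thm. 7.10 (i) for de
Rham's comparison), and (K) the Kodaira–Serre sections of the proof of Cor. 11.34 on Hodge models of
the surfaces of the item.

Input (R) is now a THEOREM of the tree: `NaturalDeRhamComparisonRigidity_holds`
(`HodgeFiltrationModelsReductionProofs.lean`, from
`Literature.Geometry.Manifold.NaturalCohomologyEndo.exists_eq_smul`: natural endomorphisms of
`Hᵏ(-; ℂ)` on compact manifolds are scalars, by Morse theory). This file records the resulting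
two-input reduction against the route decl by name: the item closes the day (L) and (K) are proved
for complex model spaces of dimension `2`.
-/

noncomputable section

open scoped Manifold ContDiff
open Literature.AlgebraicGeometry
open Literature.AlgebraicGeometry.HodgeTheory
open Literature.Geometry.Kaehler (HolomorphicLineBundle MForm)
open Literature.NumberTheory.Transcendental (ComplexDeRhamIsoFamily)

namespace Summit.HodgeConjecture.HodgeConjecture.Theorems

open Summit.HodgeConjecture.HodgeConjecture.Theses.NikulinTwinTransport

/-- **`LefschetzOneOneK3` from the printed Lefschetz `(1,1)` theorem for one natural comparison
family and the Kodaira–Serre sections alone** — the rigidity hypothesis of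
`lefschetzOneOneK3_of_rigidity_of_globalSections` discharged by
`NaturalDeRhamComparisonRigidity_holds`. Remaining inputs: (L) for every finite-dimensional complex
model space `E` some natural complex de Rham comparison family satisfies Lefschetz `(1,1)` in
Chern–Weil form (Voisin I, Thm. 11.30 with Thm. 7.10 (i), for de Rham's integration comparison);
(K) on Hodge models of the surfaces of the item, every cocycle line bundle `L` admits a cocycle line
bundle `L'` with non-zero global sections of `L ⊗ L'` and of `L'` (proof of Cor. 11.34). -/
theorem lefschetzOneOneK3_of_deRhamLefschetzOneOne_of_globalSections
    (h₁ : ∀ (E : Type) [NormedAddCommGroup E] [NormedSpace ℂ E] [FiniteDimensional ℂ E],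
      ∃ e₀ : ComplexDeRhamIsoFamily E, e₀.IsNatural ∧ e₀.IsLefschetzOneOne)
    (h₂ : ∀ ⦃S : Motives.SchemeOver ℂ⦄,
      (Motives.IsSmoothProjective 2 S ∧ Subsingleton (Motives.structureSheafCohomology S.left 1) ∧
        ∃ (A : HodgeModel 2 S) (η : MForm 𝓘(ℝ, A.model) A.carrier ℂ 2),
          Literature.Geometry.Kaehler.IsHolomorphicInCharts η ∧ ∀ x, η x ≠ 0) →
      ∀ (A : HodgeModel 2 S) (ι : Type) (L : HolomorphicLineBundle ι A.model A.carrier),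
        ∃ (κ : Type) (L' : HolomorphicLineBundle κ A.model A.carrier)
          (σ₁ : (L.tensor L').GlobalSection) (σ₂ : L'.GlobalSection),
          σ₁.zeroSet ≠ Set.univ ∧ σ₂.zeroSet ≠ Set.univ) :
    LefschetzOneOneK3 :=
  lefschetzOneOneK3_of_rigidity_of_globalSections NaturalDeRhamComparisonRigidity_holds h₁ h₂

end Summit.HodgeConjecture.HodgeConjecture.Theorems

end
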